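import Mathlib
import HarnessLib
import Summits.HubbardSuperconductivity.HubbardSuperconductivity.Theses.WeakCouplingBCS
import Summits.HubbardSuperconductivity.HubbardSuperconductivity.Theorems.WeakCouplingBCSWcbcsKohnLuttingerB1gFormAWindowD005D030

/-!
# Route `WeakCouplingBCS` — rung R2d: the LOADED PAIR on the common doping window `δ ∈ [0.10, 0.30]`
# (leaf `H1TwoPointLimitKLScaleD` ∩ the certificate half with the window-extension records `klCertB1gWinX`, `klCertB1gWinY`)

Cell `gate-hubbard-kl`, seat `hubbard-kl-cert-2` gen 3 (row «window extension enclosures»; LADDER-Hubbard §0 (D): «the rung converts on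
the LOADED PAIR»; risk-register item r2 = the window).  Successor of `…Theorems.WeakCouplingBCSH1TwoPointLimitKLScaleDDopingWindowD010D025`
(seat h1-p1 gen 2: the pair on `[0.10, 0.25]`, records `Z, A, B, C`).

The certificate half now reaches `δ ≈ 0.30`: the window-extension records `klCertB1gWinX` (16 boxes on `[-0.7275, -0.6875]`) and
`klCertB1gWinY` (31 boxes on `[-0.6875, -0.5725]`) of seat cert-2 gen 2, together with `klCertB1gWin{Z,A,B,C}`, give in form (A)
(`klb1g_formA_r2d_certificate_d010_d030`, with the UNCONDITIONAL `μ(δ) ∈ [-0.7275, -0.1775]` for `δ ∈ [0.10, 0.30]`,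
`muOfDoping_mem_window_d010_d030`, read off `muWinD030_filling_lt : n(-0.7275) < 7/10` and `klfillL010_filling_ge`): for every
`δ ∈ [0.10, 0.30]`, `B1g` leads every other `D₄` channel of the second-order Kohn–Luttinger vertex at `μ(δ)` by `γ_Y U²`,
`γ_Y = 14349/1048576` (the smallest of the six record margins), for all `U ∈ (0,1)`, AND the `B1g` bottom is certified attractive,
`channelInf ε₀ μ(δ) U B1g ≤ -(1/16)·U²`.  The theorem half `H1TwoPointLimitKLScaleD` lives on `δ ∈ [0.10, 0.35]`
(restricted here as `control_extWindow030`, the content of `R2dH1.control_subwindow` of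
`…Theorems.WeakCouplingBCSH1TwoPointLimitKLScaleDPlumbing`).  Hence the loaded pair on the COMMON window `[0.10, 0.30] = [0.10, 0.35] ∩ [0.05, 0.30]`
(`klPair_doping_d010_d030`; packaged with one `(U₀, c, γ)` as `klPair_doping_d010_d030'`).  Folklore glue, items consumed BY NAME,
modulo the six named enclosure hypotheses (cert form (A)); no definitions.  Sources: S. Raghu, S. A. Kivelson, D. J. Scalapino,
Phys. Rev. B 81 (2010) 224505, §III Fig. 2; G. Benfatto, A. Giuliani, V. Mastropietro, Ann. Henri Poincaré 7 (2006) 809, Thm 1.1.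
Numerics of the records: cell HOME/hubbard-kl-cert-2/MU-WINDOW-3.md (148 μ-uniform boxes on `[-0.7275, -0.075]`, two implementations).
-/

noncomputable section

-- the tree's namespace `Summit.<Summit>.<Problem>.Theorems` repeats the summit name by design (D-0017)
set_option linter.dupNamespace false

namespace Summit.HubbardSuperconductivity.HubbardSuperconductivity.Theorems.R2dH1

open Filter Set
open Literature.MathematicalPhysics.QuantumLattice Literature.Probability.LatticeModels
open Summit.HubbardSuperconductivity.HubbardSuperconductivity.Theses.WeakCouplingBCS (H1TwoPointLimitKLScaleD)
open scoped Topology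

/-- **The leaf on the extended certificate window `δ ∈ [0.10, 0.30]`** (`⊆ [0.10, 0.35]`, same constants). [folklore] -/
theorem control_extWindow030 (h : H1TwoPointLimitKLScaleD) :
    ∃ U₀ c : ℝ, 0 < U₀ ∧ 0 < c ∧ ∀ δ ∈ Set.Icc (0.10 : ℝ) 0.30, ∀ U β : ℝ, 0 < U → U ≤ U₀ → 0 < β →
      β ≤ Real.exp (c / U ^ 2) → ∀ (x y : Site 2) (σ σ' : Fin 2), ∃ S : ℂ,
        Tendsto (fun L : ℕ => hubbardThermalTwoPoint β U
          (chemicalPotentialOfDensity (squareDispersion 1 0) (1 - δ)) L x y σ σ') atTop (𝓝 S) := by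
  -- restriction of the leaf's window `[0.10, 0.35]` (the two-line content of `R2dH1.control_subwindow`, inlined so that this
  -- consumer imports the route file itself and no module of its cone)
  obtain ⟨U₀, c, hU₀, hc, H⟩ := h
  exact ⟨U₀, c, hU₀, hc, fun δ hδ => H δ ⟨hδ.1, hδ.2.trans (by norm_num)⟩⟩

/-- **THE LOADED PAIR of rung R2d on the common window `δ ∈ [0.10, 0.30]`, explicit certificate constants.**  From the six window
enclosure records (`klCertB1gWin{X,Y,Z}` + `klCertB1gWin{A,B,C}`, cert form (A)) and the leaf `H1TwoPointLimitKLScaleD`: there are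
`U₀, c > 0` such that for every `δ ∈ [0.10, 0.30]`, at the free-band chemical potential `μ(δ)`:
(selection) `channelInf ε₀ μ(δ) U B1g + (14349/1048576)·U² ≤ channelInf ε₀ μ(δ) U χ` for all `U ∈ (0,1)` and every `χ ≠ B1g`;
(attraction) `channelInf ε₀ μ(δ) U B1g ≤ -(1/16)·U²` for every `U`; (control) the thermal two-point functions of the Hubbard torus
at `μ(δ)` converge as `L → ∞` for all `0 < U ≤ U₀`, `0 < β ≤ e^{c/U²}`. [cite: RaghuKivelsonScalapino2010, §III Fig. 2] -/
theorem klPair_doping_d010_d030 (hX : klCertB1gWinX.EnclosuresB1g) (hY : klCertB1gWinY.EnclosuresB1g)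
    (hZ : klCertB1gWinZ.EnclosuresB1g) (hA : klCertB1gWinA.EnclosuresB1g) (hB : klCertB1gWinB.EnclosuresB1g)
    (hC : klCertB1gWinC.EnclosuresB1g) (h : H1TwoPointLimitKLScaleD) :
    ∃ U₀ c : ℝ, 0 < U₀ ∧ 0 < c ∧ ∀ δ ∈ Set.Icc (0.10 : ℝ) 0.30,
      (∀ U ∈ Set.Ioo (0 : ℝ) 1, ∀ χ : D4Irrep, χ ≠ D4Irrep.B1g →
        channelInf (squareDispersion 1 0) (chemicalPotentialOfDensity (squareDispersion 1 0) (1 - δ)) U D4Irrep.B1g +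
            (14349 / 1048576 : ℝ) * U ^ 2 ≤
          channelInf (squareDispersion 1 0) (chemicalPotentialOfDensity (squareDispersion 1 0) (1 - δ)) U χ) ∧
      (∀ U : ℝ, channelInf (squareDispersion 1 0) (chemicalPotentialOfDensity (squareDispersion 1 0) (1 - δ)) U
          D4Irrep.B1g ≤ -(1 / 16 : ℝ) * U ^ 2) ∧
      (∀ U β : ℝ, 0 < U → U ≤ U₀ → 0 < β → β ≤ Real.exp (c / U ^ 2) →
        ∀ (x y : Site 2) (σ σ' : Fin 2), ∃ S : ℂ,
          Tendsto (fun L : ℕ => hubbardThermalTwoPoint β U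
            (chemicalPotentialOfDensity (squareDispersion 1 0) (1 - δ)) L x y σ σ') atTop (𝓝 S)) := by
  obtain ⟨U₀, c, hU₀, hc, H⟩ := control_extWindow030 h
  have hcert := klb1g_formA_r2d_certificate_d010_d030 hX hY hZ hA hB hC
  exact ⟨U₀, c, hU₀, hc, fun δ hδ => ⟨(hcert δ hδ).1, (hcert δ hδ).2, H δ hδ⟩⟩

/-- **The loaded pair on `[0.10, 0.30]`, packaged with ONE set of constants `(U₀, c, γ)`** (the shape of
`R2dH1.klPair_doping_d010_d020` on the window of record; here `γ = 14349/1048576` and `U₀ ≤ 1`). [cite: RaghuKivelsonScalapino2010, §III Fig. 2] -/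
theorem klPair_doping_d010_d030' (hX : klCertB1gWinX.EnclosuresB1g) (hY : klCertB1gWinY.EnclosuresB1g)
    (hZ : klCertB1gWinZ.EnclosuresB1g) (hA : klCertB1gWinA.EnclosuresB1g) (hB : klCertB1gWinB.EnclosuresB1g)
    (hC : klCertB1gWinC.EnclosuresB1g) (h : H1TwoPointLimitKLScaleD) :
    ∃ U₀ c γ : ℝ, 0 < U₀ ∧ 0 < c ∧ 0 < γ ∧ ∀ δ ∈ Set.Icc (0.10 : ℝ) 0.30,
      (∀ U ∈ Set.Ioo (0 : ℝ) U₀, ∀ χ : D4Irrep, χ ≠ D4Irrep.B1g →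
        channelInf (squareDispersion 1 0) (chemicalPotentialOfDensity (squareDispersion 1 0) (1 - δ)) U D4Irrep.B1g +
            γ * U ^ 2 ≤
          channelInf (squareDispersion 1 0) (chemicalPotentialOfDensity (squareDispersion 1 0) (1 - δ)) U χ) ∧
      (∀ U β : ℝ, 0 < U → U ≤ U₀ → 0 < β → β ≤ Real.exp (c / U ^ 2) →
        ∀ (x y : Site 2) (σ σ' : Fin 2), ∃ S : ℂ,
          Tendsto (fun L : ℕ => hubbardThermalTwoPoint β U
            (chemicalPotentialOfDensity (squareDispersion 1 0) (1 - δ)) L x y σ σ') atTop (𝓝 S)) := by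
  obtain ⟨U₀, c, hU₀, hc, H⟩ := klPair_doping_d010_d030 hX hY hZ hA hB hC h
  refine ⟨min U₀ 1, c, 14349 / 1048576, lt_min hU₀ one_pos, hc, by norm_num, fun δ hδ => ⟨?_, ?_⟩⟩
  · intro U hU χ hχ
    exact (H δ hδ).1 U ⟨hU.1, lt_of_lt_of_le hU.2 (min_le_right _ _)⟩ χ hχ
  · intro U β hU hUle
    exact (H δ hδ).2.2 U β hU (hUle.trans (min_le_left _ _))

/-- **Monotonicity in the window: the pair on `[0.10, 0.30]` restricts to the pair of record on `[0.10, 0.25]`'s SHAPE with the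
weaker constants** — for every `δ ∈ [0.10, 0.25]` the conclusions of `klPair_doping_d010_d030` hold (a consumer that already
reads `[0.10, 0.25]` may take the six-record hypotheses instead of the four-record ones at the price `16905 → 14349`, `1/12 → 1/16`).
[folklore] -/
theorem klPair_doping_d010_d025_of_d030 (hX : klCertB1gWinX.EnclosuresB1g) (hY : klCertB1gWinY.EnclosuresB1g)
    (hZ : klCertB1gWinZ.EnclosuresB1g) (hA : klCertB1gWinA.EnclosuresB1g) (hB : klCertB1gWinB.EnclosuresB1g)
    (hC : klCertB1gWinC.EnclosuresB1g) (h : H1TwoPointLimitKLScaleD) :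
    ∃ U₀ c : ℝ, 0 < U₀ ∧ 0 < c ∧ ∀ δ ∈ Set.Icc (0.10 : ℝ) 0.25,
      (∀ U ∈ Set.Ioo (0 : ℝ) 1, ∀ χ : D4Irrep, χ ≠ D4Irrep.B1g →
        channelInf (squareDispersion 1 0) (chemicalPotentialOfDensity (squareDispersion 1 0) (1 - δ)) U D4Irrep.B1g +
            (14349 / 1048576 : ℝ) * U ^ 2 ≤
          channelInf (squareDispersion 1 0) (chemicalPotentialOfDensity (squareDispersion 1 0) (1 - δ)) U χ) ∧
      (∀ U : ℝ, channelInf (squareDispersion 1 0) (chemicalPotentialOfDensity (squareDispersion 1 0) (1 - δ)) U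
          D4Irrep.B1g ≤ -(1 / 16 : ℝ) * U ^ 2) ∧
      (∀ U β : ℝ, 0 < U → U ≤ U₀ → 0 < β → β ≤ Real.exp (c / U ^ 2) →
        ∀ (x y : Site 2) (σ σ' : Fin 2), ∃ S : ℂ,
          Tendsto (fun L : ℕ => hubbardThermalTwoPoint β U
            (chemicalPotentialOfDensity (squareDispersion 1 0) (1 - δ)) L x y σ σ') atTop (𝓝 S)) := by
  obtain ⟨U₀, c, hU₀, hc, H⟩ := klPair_doping_d010_d030 hX hY hZ hA hB hC h
  exact ⟨U₀, c, hU₀, hc, fun δ hδ => H δ ⟨hδ.1, hδ.2.trans (by norm_num)⟩⟩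

end Summit.HubbardSuperconductivity.HubbardSuperconductivity.Theorems.R2dH1

end
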